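import Summits.RiemannHypothesis.RiemannHypothesis.Theorems.WeilGroundStateGroundStatesConvergeToXiStubStrongClassPairing
import Summits.RiemannHypothesis.RiemannHypothesis.Theorems.WeilGroundStateGroundStatesConvergeToXiStubHarmonicExtension
import Summits.RiemannHypothesis.RiemannHypothesis.Theorems.WeilGroundStateGroundStatesConvergeToXiRHofTight
import Literature.NumberTheory.LFunctions.WeilExplicit
import Literature.NumberTheory.LFunctions.WeilExplicitProofs
import Literature.NumberTheory.LFunctions.WeilSmallSupportPositivity
import Mathlib.Analysis.Calculus.IteratedDeriv.Lemmas
import Mathlib.Analysis.Convolution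
import HarnessLib

/-!
# `WeilGroundState.GroundStatesConvergeToXi` — pairing weighted-`L¹` functions with a test function
(crux item stmt-RiemannHypothesis-1527, route route-RiemannHypothesis-WeilGroundState; line `Sketch`,
stub `stub_weilConv_pairing` (H3); `--supports`)

(A) For a Weil test function `h` (smooth of compact support), rates `0 ≤ b₀ ≤ b₁` and an order
`n`, the map `f ↦ f ⋆ h̃` (`h̃ = weilReflect h`, `h̃(t) = conj h(-t)`) is bounded from weighted
`L¹(e^{b₁|t|} dt)` into the `n`-th seminorm of the exponential Weil class with a constant that
does NOT depend on `f`: for every a.e.-strongly measurable `f` with `∫ ‖f‖ e^{b₁|t|} < ∞`,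
`f ⋆ h̃` is smooth and `‖(f ⋆ h̃)^{(n)}(t)‖ ≤ C (∫ ‖f(u)‖ e^{b₁|u|} du) e^{-b₀|t|}`,
`C = C(h, n, b₀) ≥ 0`.  Proof: `h̃` is again a test, so `‖h̃^{(n)}(t)‖ ≤ C_n e^{-b₀|t|}`
(`hExt_strong_of_isWeilTest`) and every `h̃^{(m)}` is bounded; `f ∈ L¹` (`scPair_integrable`,
`b₁ ≥ 0`), `f ⋆ h̃` is smooth with `(f ⋆ h̃)^{(n)} = f ⋆ h̃^{(n)}` (`scPair_contDiff`,
`scPair_iteratedDeriv_eq`: differentiation under the integral sign), and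
`‖(f ⋆ k)(t)‖ ≤ (max C_n 0 · ∫ ‖f‖ e^{b₁|u|}) e^{-b₀|t|}` whenever `‖k‖ ≤ C_n e^{-b₀|·|}`
(`scPair_norm_weilConv_le`, from `e^{-b₀|t-u|} ≤ e^{-b₀|t|} e^{b₁|u|}`); take `C = max C_n 0`.

(B) Weak convergence against test functions passes to the convolutions pointwise: by
`weilConv_apply`, `(f_k ⋆ h̃)(x) = ∫ f_k(u) h̃(x - u) du = ∫ f_k(u) conj h(u - x) du`, and
`u ↦ conj h(u - x)` is a test function (`isWeilTest_conj`, `isWeilTest_translate`), so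
`∫ f_k g → ∫ v g` for all tests `g` gives `(f_k ⋆ h̃)(x) → (v ⋆ h̃)(x)` for every `x`.

No new definitions; no named fact is used.
-/

noncomputable section

set_option linter.dupNamespace false

open scoped Topology Real ComplexConjugate
open Filter Set MeasureTheory Complex

namespace Summit.RiemannHypothesis.RiemannHypothesis.Theorems.GroundStatesConvergeToXi

open Literature.NumberTheory.LFunctions

/-! ## (A) Uniform class bounds for `f ⋆ h̃` -/

/-- Every iterated derivative of the reflection `h̃` of a test function `h` is `O(e^{-b₀|t|})`
for every rate `b₀ ≥ 0` (`h̃` is a test, `IsWeilTest.weilReflect`; `hExt_strong_of_isWeilTest`).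
[folklore] -/
theorem wcPair_norm_iteratedDeriv_weilReflect_le {h : ℝ → ℂ} (hh : IsWeilTest h) {b₀ : ℝ}
    (hb₀ : 0 ≤ b₀) (n : ℕ) :
    ∃ C : ℝ, ∀ t : ℝ, ‖iteratedDeriv n (weilReflect h) t‖ ≤ C * Real.exp (-(b₀ * |t|)) :=
  hExt_strong_of_isWeilTest hh.weilReflect hb₀ n

/-- Every iterated derivative of the reflection `h̃` of a test function `h` is bounded
(the rate-`0` case of `wcPair_norm_iteratedDeriv_weilReflect_le`). [folklore] -/
theorem wcPair_norm_iteratedDeriv_weilReflect_bdd {h : ℝ → ℂ} (hh : IsWeilTest h) (n : ℕ) :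
    ∃ B : ℝ, ∀ x : ℝ, ‖iteratedDeriv n (weilReflect h) x‖ ≤ B := by
  obtain ⟨C, hC⟩ := wcPair_norm_iteratedDeriv_weilReflect_le hh le_rfl n
  exact ⟨C, fun x => by simpa using hC x⟩

/-- **(A), curried: `f ↦ f ⋆ h̃` is bounded from weighted `L¹` into the exponential class,
uniformly in `f`.**  For a test `h`, rates `0 ≤ b₀ ≤ b₁` and an order `n` there is `C ≥ 0` such
that for every a.e.-strongly measurable `f` with `∫ ‖f‖ e^{b₁|t|} < ∞` the convolution `f ⋆ h̃`
is smooth and `‖(f ⋆ h̃)^{(n)}(t)‖ ≤ C (∫ ‖f(u)‖ e^{b₁|u|} du) e^{-b₀|t|}` for all `t`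
(`scPair_integrable`, `scPair_contDiff`, `scPair_iteratedDeriv_eq`, `scPair_norm_weilConv_le`
with `k = h̃^{(n)}`, `C = max C_n 0`). [folklore] -/
theorem weilConv_weilReflect_contDiff_and_bound {h : ℝ → ℂ} {b₀ b₁ : ℝ} (hb₀ : 0 ≤ b₀)
    (hle : b₀ ≤ b₁) (hh : IsWeilTest h) (n : ℕ) :
    ∃ C : ℝ, 0 ≤ C ∧ ∀ f : ℝ → ℂ, AEStronglyMeasurable f volume →
      Integrable (fun t : ℝ => ‖f t‖ * Real.exp (b₁ * |t|)) →
      ContDiff ℝ (⊤ : ℕ∞) (weilConv f (weilReflect h)) ∧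
      ∀ t : ℝ, ‖iteratedDeriv n (weilConv f (weilReflect h)) t‖ ≤
        C * (∫ u, ‖f u‖ * Real.exp (b₁ * |u|)) * Real.exp (-(b₀ * |t|)) := by
  have hrc : ContDiff ℝ (⊤ : ℕ∞) (weilReflect h) := scPair_contDiff_weilReflect hh.1
  have hrb' : ∀ m : ℕ, ∃ B : ℝ, ∀ x, ‖iteratedDeriv m (weilReflect h) x‖ ≤ B :=
    fun m => wcPair_norm_iteratedDeriv_weilReflect_bdd hh m
  obtain ⟨C, hC⟩ := wcPair_norm_iteratedDeriv_weilReflect_le hh hb₀ n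
  refine ⟨max C 0, le_max_right _ _, fun f hf hint => ?_⟩
  have hfi : Integrable f := scPair_integrable hf (hb₀.trans hle) hint
  refine ⟨scPair_contDiff hfi hrc hrb', fun t => ?_⟩
  rw [scPair_iteratedDeriv_eq hfi hrc hrb' n]
  exact scPair_norm_weilConv_le hint hb₀ hle hC t

/-! ## (B) Weak convergence against tests gives pointwise convergence of `f_k ⋆ h̃` -/

/-- For a test function `h` and a point `x`, `u ↦ h̃(x - u) = conj h(u - x)` is a test function
(`isWeilTest_conj`, `isWeilTest_translate`). [folklore] -/
theorem isWeilTest_weilReflect_sub {h : ℝ → ℂ} (hh : IsWeilTest h) (x : ℝ) :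
    IsWeilTest fun u : ℝ => weilReflect h (x - u) := by
  have e : (fun u : ℝ => weilReflect h (x - u)) = fun t : ℝ => conj (h (t + -x)) := by
    funext u
    simp only [weilReflect, neg_sub]
    rw [sub_eq_add_neg]
  rw [e]
  exact isWeilTest_translate (isWeilTest_conj hh) (-x)

/-- **(B), curried: weak convergence passes to the convolutions pointwise.**  If
`∫ f_k g → ∫ v g` for every test function `g`, then `(f_k ⋆ h̃)(x) → (v ⋆ h̃)(x)` for every test
`h` and every `x`: `(w ⋆ h̃)(x) = ∫ w(u) h̃(x - u) du` (`weilConv_apply`) and `u ↦ h̃(x - u)` is a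
test (`isWeilTest_weilReflect_sub`). [folklore] -/
theorem tendsto_weilConv_of_weak {f : ℕ → ℝ → ℂ} {v h : ℝ → ℂ} (hh : IsWeilTest h)
    (hweak : ∀ g : ℝ → ℂ, IsWeilTest g →
      Tendsto (fun k => ∫ t, f k t * g t) atTop (𝓝 (∫ t, v t * g t))) (x : ℝ) :
    Tendsto (fun k => weilConv (f k) (weilReflect h) x) atTop
      (𝓝 (weilConv v (weilReflect h) x)) := by
  simp only [weilConv_apply]
  exact hweak _ (isWeilTest_weilReflect_sub hh x)

/-! ## The stub -/

/-- **Stub H3 — `weilConv_pairing` (RH-free).**  (A) For a test function `h` and rates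
`0 ≤ b₀ ≤ b₁` the map `f ↦ f ⋆ h̃` is bounded from weighted `L¹(e^{b₁|t|})` into every seminorm of
the exponential Weil class: `f ⋆ h̃` is smooth and `‖(f ⋆ h̃)^{(n)}(t)‖ ≤ C ‖f‖_{L¹(e^{b₁|·|})} e^{-b₀|t|}`
with `C = C(h, n, b₀) ≥ 0` INDEPENDENT of `f` (`weilConv_weilReflect_contDiff_and_bound`).
(B) Weak convergence against test functions passes to the convolutions pointwise:
`(f_k ⋆ h̃)(x) = ∫ f_k(u) conj h(u - x) du → (v ⋆ h̃)(x)` (`tendsto_weilConv_of_weak`). [folklore] -/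
theorem stub_weilConv_pairing :
    (∀ (h : ℝ → ℂ) (b₀ b₁ : ℝ), 0 ≤ b₀ → b₀ ≤ b₁ → IsWeilTest h → ∀ n : ℕ, ∃ C : ℝ, 0 ≤ C ∧
      ∀ f : ℝ → ℂ, AEStronglyMeasurable f volume →
        Integrable (fun t : ℝ => ‖f t‖ * Real.exp (b₁ * |t|)) →
        ContDiff ℝ (⊤ : ℕ∞) (weilConv f (weilReflect h)) ∧
        ∀ t : ℝ, ‖iteratedDeriv n (weilConv f (weilReflect h)) t‖ ≤
          C * (∫ u, ‖f u‖ * Real.exp (b₁ * |u|)) * Real.exp (-(b₀ * |t|))) ∧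
    (∀ (f : ℕ → ℝ → ℂ) (v h : ℝ → ℂ), IsWeilTest h →
      (∀ g : ℝ → ℂ, IsWeilTest g →
        Tendsto (fun k => ∫ t, f k t * g t) atTop (𝓝 (∫ t, v t * g t))) →
      ∀ x : ℝ, Tendsto (fun k => weilConv (f k) (weilReflect h) x) atTop
        (𝓝 (weilConv v (weilReflect h) x))) :=
  ⟨fun _ _ _ hb₀ hle hh n => weilConv_weilReflect_contDiff_and_bound hb₀ hle hh n,
    fun _ _ _ hh hweak x => tendsto_weilConv_of_weak hh hweak x⟩

end Summit.RiemannHypothesis.RiemannHypothesis.Theorems.GroundStatesConvergeToXi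

end
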